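import Summits.AnomalousDissipation.AnomalousDissipation.Theorems.ScalarAnomalySteadySourceFormal.Negative.DriftCore

/-!
# Negative knowledge for the crux `ScalarAnomalySteadySourceFormal` (stmt-AnomalousDissipation-0448), VI-c: the dissipation CEILING of a constant-drift witness

Certified copy of §8 (part 3): `∫₀ᵀ‖∇θ‖² ≤ ‖θ₀-θ_p‖²/ν + 8π²T∑|k|²‖𝓕θ_p(k)‖²` and `⟨ν‖∇θ‖²⟩ ≤ 8π²ν∑|k|²‖𝓕θ_p(k)‖²` (transients average out; Parseval), with the summability of the steady coefficients.
Supports stmt-AnomalousDissipation-0448.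
-/

set_option linter.dupNamespace false

noncomputable section

open scoped BigOperators Topology ENNReal NNReal InnerProductSpace ContDiff
open MeasureTheory Set Filter Function UnitAddTorus Complex

namespace Summit.AnomalousDissipation.AnomalousDissipation.Theorems.ScalarAnomalySteadySourceFormal.Negative

open Literature.Analysis
open Literature.Analysis.FunctionSpaces Literature.Analysis.FunctionSpaces.Torus
open Literature.Analysis.FluidPDE Literature.Analysis.FluidPDE.Torus

variable {d : Type*} [Fintype d] [DecidableEq d]
/-! ### The dissipation of a constant-drift witness: `limsup ⟨ν‖∇θ‖²⟩ ≤ 8π²ν ∑ₖ |k|² ‖𝓕θ_p(k)‖²` -/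

section DriftDissipation

variable {ν : ℝ} {c : EuclideanSpace ℝ d} {h θ₀ : UnitAddTorus d → ℝ} {θ : ℝ → UnitAddTorus d → ℝ}

omit [DecidableEq d] in
/-- `s ↦ eScalarGradNormSq (θ s)` is a.e.-measurable on `(0,T)` (forced class). [folklore] -/
theorem forced_aemeasurable_eScalarGradNormSq {T κ : ℝ} {u : ℝ → UnitAddTorus d → EuclideanSpace ℝ d}
    {src : ℝ → UnitAddTorus d → ℝ} (hw : IsWeakScalarTransportForcedOn T κ u src θ₀ θ) :
    AEMeasurable (fun s => eScalarGradNormSq (θ s)) ((volume : Measure ℝ).restrict (Ioo 0 T)) := by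
  have hcoef : ∀ k : d → ℤ, AEStronglyMeasurable (fun s => mFourierCoeff (fun x => (θ s x : ℂ)) k)
      ((volume : Measure ℝ).restrict (Ioo 0 T)) := by
    intro k
    have e : (fun s => mFourierCoeff (fun x => (θ s x : ℂ)) k) = fun s => ∫ x, mFourier (-k) x • (θ s x : ℂ) := by
      funext s
      exact FunctionSpaces.Torus.mFourierCoeff_eq_integral_volume _ k
    rw [e]
    have hm : AEStronglyMeasurable (uncurry fun s x => mFourier (-k) x • (θ s x : ℂ))
        (((volume : Measure ℝ).restrict (Ioo 0 T)).prod volume) :=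
      ((mFourier (-k)).continuous.comp continuous_snd).aestronglyMeasurable.smul
        (Complex.continuous_ofReal.comp_aestronglyMeasurable (forced_aestronglyMeasurable_uncurry hw))
    exact hm.integral_prod_right'
  have e : (fun s => eScalarGradNormSq (θ s)) = fun s => ENNReal.ofReal (4 * Real.pi ^ 2) *
      ∑' k : d → ℤ, ENNReal.ofReal (FunctionSpaces.Torus.freqNormSq k) * ‖mFourierCoeff (fun x => (θ s x : ℂ)) k‖ₑ ^ 2 := by
    funext s
    exact eScalarGradNormSq_eq_tsum (θ s)
  rw [e]
  refine AEMeasurable.const_mul (AEMeasurable.tsum fun k => ?_) _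
  exact (((hcoef k).enorm.pow_const 2).const_mul _)

omit [Fintype d] [DecidableEq d] in
/-- `‖u + v‖ₑ² ≤ 2‖u‖ₑ² + 2‖v‖ₑ²` in `ℂ`. [folklore] -/
theorem enorm_add_sq_le (u v : ℂ) : ‖u + v‖ₑ ^ 2 ≤ 2 * ‖u‖ₑ ^ 2 + 2 * ‖v‖ₑ ^ 2 := by
  have e : ∀ w : ℂ, ‖w‖ₑ ^ 2 = ENNReal.ofReal (‖w‖ ^ 2) := fun w => by
    rw [← ofReal_norm, ENNReal.ofReal_pow (norm_nonneg _)]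
  have key : ‖u + v‖ ^ 2 ≤ 2 * ‖u‖ ^ 2 + 2 * ‖v‖ ^ 2 := by
    nlinarith [norm_add_le u v, norm_nonneg u, norm_nonneg v, norm_nonneg (u + v), sq_nonneg (‖u‖ - ‖v‖)]
  calc ‖u + v‖ₑ ^ 2 = ENNReal.ofReal (‖u + v‖ ^ 2) := e _
    _ ≤ ENNReal.ofReal (2 * ‖u‖ ^ 2 + 2 * ‖v‖ ^ 2) := ENNReal.ofReal_le_ofReal key
    _ = 2 * ‖u‖ₑ ^ 2 + 2 * ‖v‖ₑ ^ 2 := by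
        rw [ENNReal.ofReal_add (by positivity) (by positivity), ENNReal.ofReal_mul (by norm_num),
          ENNReal.ofReal_mul (by norm_num), ENNReal.ofReal_ofNat, e u, e v]

omit [Fintype d] [DecidableEq d] in
/-- `∫₀ᵀ e^{-bt} dt ≤ 1/b` for `b > 0`, in `ℝ≥0∞`. [folklore] -/
theorem lintegral_exp_neg_le {b T : ℝ} (hb : 0 < b) (hT : 0 ≤ T) :
    ∫⁻ t in Ioo 0 T, ENNReal.ofReal (Real.exp (-b * t)) ≤ ENNReal.ofReal (1 / b) := by
  have hcont : Continuous fun t : ℝ => Real.exp (-b * t) := Real.continuous_exp.comp (continuous_const.mul continuous_id)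
  have hint : IntegrableOn (fun t => Real.exp (-b * t)) (Ioo 0 T) volume :=
    (hcont.integrableOn_Icc).mono_set Ioo_subset_Icc_self
  rw [← ofReal_integral_eq_lintegral_ofReal hint (ae_of_all _ fun t => (Real.exp_pos _).le)]
  refine ENNReal.ofReal_le_ofReal ?_
  rw [← integral_Ioc_eq_integral_Ioo, ← intervalIntegral.integral_of_le hT]
  have hderiv : ∀ t ∈ uIcc 0 T, HasDerivAt (fun τ => -(Real.exp (-b * τ)) / b) (Real.exp (-b * t)) t := by
    intro t _
    have h1 : HasDerivAt (fun τ => -b * τ) (-b) t := by simpa using (hasDerivAt_id t).const_mul (-b)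
    have h2 := h1.exp
    have h3 := (h2.neg).div_const b
    refine h3.congr_deriv ?_
    rw [mul_neg, neg_neg, mul_div_cancel_right₀ _ hb.ne']
  rw [intervalIntegral.integral_eq_sub_of_hasDerivAt hderiv (hcont.intervalIntegrable _ _)]
  have h0 : Real.exp (-b * T) > 0 := Real.exp_pos _
  rw [mul_zero, Real.exp_zero]
  have : -(Real.exp (-b * T)) / b - -1 / b = (1 - Real.exp (-b * T)) / b := by ring
  rw [this]
  exact div_le_div_of_nonneg_right (by linarith) hb.le

end DriftDissipation

section DriftDissipationMain

variable {ν : ℝ} {c : EuclideanSpace ℝ d} {h θ₀ : UnitAddTorus d → ℝ} {θ : ℝ → UnitAddTorus d → ℝ}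

omit [Fintype d] [DecidableEq d] in
/-- Parseval in `ℝ≥0∞`: `∑ₖ ‖𝓕f(k)‖ₑ² = ofReal (∫ f²)` for real `f ∈ L²`. [folklore] -/
theorem tsum_enorm_sq_mFourierCoeff [Fintype d] {f : UnitAddTorus d → ℝ} (hf : MemLp f 2 volume) :
    ∑' k : d → ℤ, ‖mFourierCoeff (fun x => (f x : ℂ)) k‖ₑ ^ 2 = ENNReal.ofReal (∫ x, f x ^ 2) := by
  have hpar := FunctionSpaces.Torus.hasSum_sq_norm_mFourierCoeff_ofReal hf
  have h1 : ∀ k, ‖mFourierCoeff (fun x => (f x : ℂ)) k‖ₑ ^ 2 = ENNReal.ofReal (‖mFourierCoeff (fun x => (f x : ℂ)) k‖ ^ 2) :=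
    fun k => by rw [← ofReal_norm, ENNReal.ofReal_pow (norm_nonneg _)]
  simp_rw [h1]
  rw [← ENNReal.ofReal_tsum_of_nonneg (fun k => sq_nonneg _) hpar.summable, hpar.tsum_eq]

/-- **Time-integrated gradient bound** for a constant-drift witness: for every `T > 0`,
`∫₀ᵀ ‖∇θ‖² ≤ ‖θ₀ - θ_p‖²/ν + 8π² T ∑ₖ |k|² ‖𝓕θ_p(k)‖²` (modes: `|e^{-a_k t}z_k + P_k|² ≤ 2e^{-8π²ν|k|²t}|z_k|² + 2|P_k|²`,
`∫₀^∞ 8π²|k|² e^{-8π²ν|k|²t} dt = 1/ν`, Parseval). [folklore] -/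
theorem d_lintegral_grad_le (hν : 0 < ν) (hh : IsSmooth h) (hmean : HasZeroMean h) (hθ₀ : MemLp θ₀ 2 volume)
    (hweak : IsWeakScalarTransportForced ν (fun (_ : ℝ) (_ : UnitAddTorus d) => c) (fun _ => h) θ₀ θ)
    {T : ℝ} (hT : 0 < T)
    (hD : Summable fun k : d → ℤ => freqNormSq k * ‖mFourierCoeff (fun x => (driftState ν c h x : ℂ)) k‖ ^ 2) :
    ∫⁻ t in Ioo 0 T, eScalarGradNormSq (θ t) ≤
      ENNReal.ofReal ((∫ x, (θ₀ x - driftState ν c h x) ^ 2) / ν +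
        8 * Real.pi ^ 2 * T * ∑' k, freqNormSq k * ‖mFourierCoeff (fun x => (driftState ν c h x : ℂ)) k‖ ^ 2) := by
  set P : (d → ℤ) → ℂ := fun k => mFourierCoeff (fun x => (driftState ν c h x : ℂ)) k with hP
  set z : (d → ℤ) → ℂ := fun k => mFourierCoeff (fun x => ((θ₀ x - driftState ν c h x : ℝ) : ℂ)) k with hz
  set a : (d → ℤ) → ℝ := fun k => 4 * Real.pi ^ 2 * ν * freqNormSq k with ha
  set D : ℝ := ∑' k, freqNormSq k * ‖P k‖ ^ 2 with hDdef
  set V : ℝ := ∫ x, (θ₀ x - driftState ν c h x) ^ 2 with hV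
  have hθp : IsSmooth (driftState ν c h) := isSmooth_driftState hν c hh
  have hdat : MemLp (fun x => θ₀ x - driftState ν c h x) 2 volume := hθ₀.sub (hθp.memLp 2)
  -- (1) simultaneous modal formula, a.e. in `t`
  have hall : ∀ᵐ t ∂((volume : Measure ℝ).restrict (Ioo 0 T)), ∀ k : d → ℤ,
      mFourierCoeff (fun x => (θ t x : ℂ)) k = Complex.exp (-(driftSymbol ν c k) * t) * z k + P k := by
    refine ae_all_iff.2 fun k => ?_
    filter_upwards [d_ae_slice hν hh hweak hT k, dtilde_mode_eq hν hh hmean hθ₀ hweak hT k] with t ht hm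
    rw [ht.2.2, hm]
  -- (2) the explicit bound function
  set Bf : ℝ → ℝ≥0∞ := fun t => ENNReal.ofReal (4 * Real.pi ^ 2) *
    ∑' k, ENNReal.ofReal (freqNormSq k) * (2 * ENNReal.ofReal (Real.exp (-(2 * a k) * t)) * ‖z k‖ₑ ^ 2 + 2 * ‖P k‖ₑ ^ 2) with hBf
  have hGB : ∀ᵐ t ∂((volume : Measure ℝ).restrict (Ioo 0 T)), eScalarGradNormSq (θ t) ≤ Bf t := by
    filter_upwards [hall] with t ht
    rw [eScalarGradNormSq_eq_tsum]
    simp only [hBf]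
    have hterm : ∀ k, ENNReal.ofReal (freqNormSq k) * ‖mFourierCoeff (fun x => (θ t x : ℂ)) k‖ₑ ^ 2 ≤
        ENNReal.ofReal (freqNormSq k) * (2 * ENNReal.ofReal (Real.exp (-(2 * a k) * t)) * ‖z k‖ₑ ^ 2 + 2 * ‖P k‖ₑ ^ 2) := by
      intro k
      rw [ht k]
      have hexp2 : Real.exp (-(a k) * t) ^ 2 = Real.exp (-(2 * a k) * t) := by
        rw [← Real.exp_nat_mul]; congr 1; push_cast; ring
      have e3 : ‖Complex.exp (-(driftSymbol ν c k) * t) * z k‖ₑ ^ 2 = ENNReal.ofReal (Real.exp (-(2 * a k) * t)) * ‖z k‖ₑ ^ 2 := by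
        rw [enorm_mul, mul_pow, ← ofReal_norm, norm_cexp_neg_driftSymbol, ← ENNReal.ofReal_pow (Real.exp_pos _).le]
        simp only [ha] at hexp2 ⊢
        rw [hexp2]
      have h4 := enorm_add_sq_le (Complex.exp (-(driftSymbol ν c k) * t) * z k) (P k)
      rw [e3, ← mul_assoc] at h4
      exact mul_le_mul_right h4 _
    exact mul_le_mul_right (ENNReal.tsum_le_tsum hterm) _
  -- (3) integrate the bound termwise
  have hmeas_term : ∀ k, Measurable fun t : ℝ => ENNReal.ofReal (freqNormSq k) *
      (2 * ENNReal.ofReal (Real.exp (-(2 * a k) * t)) * ‖z k‖ₑ ^ 2 + 2 * ‖P k‖ₑ ^ 2) := by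
    intro k
    have : Measurable fun t : ℝ => ENNReal.ofReal (Real.exp (-(2 * a k) * t)) :=
      ENNReal.measurable_ofReal.comp (Real.continuous_exp.comp (continuous_const.mul continuous_id)).measurable
    exact ((this.const_mul _).mul_const _ |>.add_const _ |>.const_mul _)
  have hint_term : ∀ k, ∫⁻ t in Ioo 0 T, ENNReal.ofReal (freqNormSq k) *
      (2 * ENNReal.ofReal (Real.exp (-(2 * a k) * t)) * ‖z k‖ₑ ^ 2 + 2 * ‖P k‖ₑ ^ 2) ≤
      ENNReal.ofReal (1 / (4 * Real.pi ^ 2 * ν)) * ‖z k‖ₑ ^ 2 + ENNReal.ofReal (2 * T * (freqNormSq k * ‖P k‖ ^ 2)) := by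
    intro k
    have hmexp : Measurable fun t : ℝ => ENNReal.ofReal (Real.exp (-(2 * a k) * t)) :=
      ENNReal.measurable_ofReal.comp (Real.continuous_exp.comp (continuous_const.mul continuous_id)).measurable
    rw [lintegral_const_mul _ (((hmexp.const_mul _).mul_const _).add_const _),
      lintegral_add_right _ measurable_const, lintegral_mul_const _ (hmexp.const_mul _),
      lintegral_const_mul _ hmexp, setLIntegral_const, Real.volume_Ioo]
    by_cases hk : k = 0
    · subst hk
      simp [FunctionSpaces.Torus.freqNormSq]
    have hfk : 0 < freqNormSq k := lt_of_lt_of_le one_pos (FunctionSpaces.Torus.one_le_freqNormSq_of_ne_zero hk)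
    have hak : 0 < a k := by simp only [ha]; positivity
    have hI := lintegral_exp_neg_le (b := 2 * a k) (T := T) (by positivity) hT.le
    have e2 : ‖P k‖ₑ ^ 2 = ENNReal.ofReal (‖P k‖ ^ 2) := by rw [← ofReal_norm, ENNReal.ofReal_pow (norm_nonneg _)]
    calc ENNReal.ofReal (freqNormSq k) * (2 * (∫⁻ t in Ioo 0 T, ENNReal.ofReal (Real.exp (-(2 * a k) * t))) * ‖z k‖ₑ ^ 2 +
          2 * ‖P k‖ₑ ^ 2 * ENNReal.ofReal (T - 0))
        ≤ ENNReal.ofReal (freqNormSq k) * (2 * ENNReal.ofReal (1 / (2 * a k)) * ‖z k‖ₑ ^ 2 +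
          2 * ‖P k‖ₑ ^ 2 * ENNReal.ofReal (T - 0)) := by gcongr
      _ = ENNReal.ofReal (freqNormSq k * (2 * (1 / (2 * a k)))) * ‖z k‖ₑ ^ 2 +
          ENNReal.ofReal (2 * T * (freqNormSq k * ‖P k‖ ^ 2)) := by
          rw [mul_add, sub_zero, e2, ← ENNReal.ofReal_ofNat 2, ← ENNReal.ofReal_mul (by norm_num),
            ← mul_assoc, ← ENNReal.ofReal_mul hfk.le]
          congr 1
          rw [show ENNReal.ofReal (freqNormSq k) * (ENNReal.ofReal 2 * ENNReal.ofReal (‖P k‖ ^ 2) * ENNReal.ofReal T) =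
            ENNReal.ofReal (freqNormSq k * (2 * ‖P k‖ ^ 2 * T)) by
              rw [← ENNReal.ofReal_mul (by norm_num), ← ENNReal.ofReal_mul (by positivity), ← ENNReal.ofReal_mul hfk.le]]
          congr 1
          ring
      _ = ENNReal.ofReal (1 / (4 * Real.pi ^ 2 * ν)) * ‖z k‖ₑ ^ 2 +
          ENNReal.ofReal (2 * T * (freqNormSq k * ‖P k‖ ^ 2)) := by
          congr 2
          simp only [ha]
          field_simp
  -- sum over `k`
  have hsum : ∫⁻ t in Ioo 0 T, Bf t ≤ ENNReal.ofReal (4 * Real.pi ^ 2) *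
      (ENNReal.ofReal (1 / (4 * Real.pi ^ 2 * ν)) * ENNReal.ofReal V + ENNReal.ofReal (2 * T * D)) := by
    simp only [hBf]
    rw [lintegral_const_mul' _ _ ENNReal.ofReal_ne_top, lintegral_tsum fun k => (hmeas_term k).aemeasurable]
    refine mul_le_mul_right ?_ _
    calc ∑' k, ∫⁻ t in Ioo 0 T, ENNReal.ofReal (freqNormSq k) *
          (2 * ENNReal.ofReal (Real.exp (-(2 * a k) * t)) * ‖z k‖ₑ ^ 2 + 2 * ‖P k‖ₑ ^ 2)
        ≤ ∑' k, (ENNReal.ofReal (1 / (4 * Real.pi ^ 2 * ν)) * ‖z k‖ₑ ^ 2 +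
          ENNReal.ofReal (2 * T * (freqNormSq k * ‖P k‖ ^ 2))) := ENNReal.tsum_le_tsum hint_term
      _ = ENNReal.ofReal (1 / (4 * Real.pi ^ 2 * ν)) * ENNReal.ofReal V + ENNReal.ofReal (2 * T * D) := by
          rw [ENNReal.tsum_add, ENNReal.tsum_mul_left, tsum_enorm_sq_mFourierCoeff hdat]
          congr 1
          rw [← ENNReal.ofReal_tsum_of_nonneg (fun k => by have := freqNormSq_nonneg k; positivity) (hD.mul_left (2 * T))]
          congr 1
          rw [tsum_mul_left]
  -- conclude
  calc ∫⁻ t in Ioo 0 T, eScalarGradNormSq (θ t) ≤ ∫⁻ t in Ioo 0 T, Bf t := lintegral_mono_ae hGB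
    _ ≤ ENNReal.ofReal (4 * Real.pi ^ 2) *
        (ENNReal.ofReal (1 / (4 * Real.pi ^ 2 * ν)) * ENNReal.ofReal V + ENNReal.ofReal (2 * T * D)) := hsum
    _ = ENNReal.ofReal (V / ν + 8 * Real.pi ^ 2 * T * D) := by
        have hV0 : 0 ≤ V := integral_nonneg fun _ => sq_nonneg _
        have hD0 : 0 ≤ D := tsum_nonneg fun k => by have := freqNormSq_nonneg k; positivity
        rw [← ENNReal.ofReal_mul (by positivity), ← ENNReal.ofReal_add (by positivity) (by positivity),
          ← ENNReal.ofReal_mul (by positivity)]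
        congr 1
        field_simp
        ring

end DriftDissipationMain

section DriftLimsup

variable {ν : ℝ} {c : EuclideanSpace ℝ d} {h θ₀ : UnitAddTorus d → ℝ} {θ : ℝ → UnitAddTorus d → ℝ}

/-- **DISSIPATION CEILING** of a constant-drift witness:
`⟨ν‖∇θ‖²⟩ ≤ 8π²ν ∑ₖ |k|² ‖𝓕θ_p(k)‖²` (transients average out). [folklore] -/
theorem d_dissipation_limsup_le (hν : 0 < ν) (hh : IsSmooth h) (hmean : HasZeroMean h) (hθ₀ : MemLp θ₀ 2 volume)
    (hweak : IsWeakScalarTransportForced ν (fun (_ : ℝ) (_ : UnitAddTorus d) => c) (fun _ => h) θ₀ θ)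
    (hD : Summable fun k : d → ℤ => freqNormSq k * ‖mFourierCoeff (fun x => (driftState ν c h x : ℂ)) k‖ ^ 2) :
    longTimeAvgSup (fun t => ν * (eScalarGradNormSq (θ t)).toReal) ≤
      8 * Real.pi ^ 2 * ν * ∑' k, freqNormSq k * ‖mFourierCoeff (fun x => (driftState ν c h x : ℂ)) k‖ ^ 2 := by
  set D : ℝ := ∑' k, freqNormSq k * ‖mFourierCoeff (fun x => (driftState ν c h x : ℂ)) k‖ ^ 2 with hDdef
  set V : ℝ := ∫ x, (θ₀ x - driftState ν c h x) ^ 2 with hV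
  set G : ℝ → ℝ≥0∞ := fun t => eScalarGradNormSq (θ t) with hG
  set gd : ℝ → ℝ := fun t => ν * (G t).toReal with hgd
  have hgd0 : ∀ t, 0 ≤ gd t := fun t => mul_nonneg hν.le ENNReal.toReal_nonneg
  have hV0 : 0 ≤ V := integral_nonneg fun _ => sq_nonneg _
  have hD0 : 0 ≤ D := tsum_nonneg fun k => by have := freqNormSq_nonneg k; positivity
  have hmean_le : ∀ T, 0 < T → timeMean gd T ≤ V / T + 8 * Real.pi ^ 2 * ν * D := by
    intro T hT
    have hL := d_lintegral_grad_le hν hh hmean hθ₀ hweak hT hD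
    have hLfin : ∫⁻ t in Ioo 0 T, G t < ⊤ := lt_of_le_of_lt hL ENNReal.ofReal_lt_top
    have hGm : AEMeasurable G (volume.restrict (Ioo 0 T)) := forced_aemeasurable_eScalarGradNormSq (hweak T hT)
    have hint : ∫ t in Ioo 0 T, (G t).toReal = (∫⁻ t in Ioo 0 T, G t).toReal :=
      integral_toReal hGm (ae_lt_top' hGm hLfin.ne)
    have htm : timeMean gd T = T⁻¹ * (ν * (∫⁻ t in Ioo 0 T, G t).toReal) := by
      rw [timeMean, intervalIntegral.integral_of_le hT.le, integral_Ioc_eq_integral_Ioo]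
      simp only [hgd]
      rw [integral_const_mul, hint]
    rw [htm]
    have h2 : (∫⁻ t in Ioo 0 T, G t).toReal ≤ V / ν + 8 * Real.pi ^ 2 * T * D := by
      have := ENNReal.toReal_mono ENNReal.ofReal_ne_top hL
      rwa [ENNReal.toReal_ofReal (by positivity)] at this
    calc T⁻¹ * (ν * (∫⁻ t in Ioo 0 T, G t).toReal) ≤ T⁻¹ * (ν * (V / ν + 8 * Real.pi ^ 2 * T * D)) := by
          gcongr
      _ = V / T + 8 * Real.pi ^ 2 * ν * D := by field_simp
  refine le_of_forall_pos_le_add fun δ hδ => ?_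
  have hcb : IsCoboundedUnder (· ≤ ·) atTop (timeMean gd) :=
    isCoboundedUnder_le_of_eventually_le atTop
      ((eventually_ge_atTop (0 : ℝ)).mono fun T hT => timeMean_nonneg hgd0 hT)
  refine limsup_le_of_le hcb ?_
  filter_upwards [eventually_gt_atTop (0 : ℝ), eventually_ge_atTop (V / δ + 1)] with T hT hTB
  refine (hmean_le T hT).trans ?_
  have : V / T ≤ δ := by
    rw [div_le_iff₀ hT]
    have h1 : V / δ < T := by linarith
    rw [div_lt_iff₀ hδ] at h1
    linarith
  linarith

/-- The steady coefficients are square-summable against `|k|²`: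
`∑ₖ |k|² ‖𝓕θ_p(k)‖² ≤ (4π²ν)⁻² ∑ₖ ‖𝓕h(k)‖² < ∞`. [folklore] -/
theorem summable_freqNormSq_mul_sq (hν : 0 < ν) (c : EuclideanSpace ℝ d) (hh : IsSmooth h) (hmean : HasZeroMean h) :
    Summable fun k : d → ℤ => freqNormSq k * ‖mFourierCoeff (fun x => (driftState ν c h x : ℂ)) k‖ ^ 2 := by
  have hpar := FunctionSpaces.Torus.hasSum_sq_norm_mFourierCoeff_ofReal (hh.memLp 2)
  refine Summable.of_nonneg_of_le (fun k => by have := freqNormSq_nonneg k; positivity) (fun k => ?_)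
    (hpar.summable.mul_left ((4 * Real.pi ^ 2 * ν) ^ 2)⁻¹)
  by_cases hk : k = 0
  · subst hk; simp [FunctionSpaces.Torus.freqNormSq]; positivity
  have hfk : 1 ≤ freqNormSq k := FunctionSpaces.Torus.one_le_freqNormSq_of_ne_zero hk
  rw [mFourierCoeff_driftState hν c hh hmean hk]
  have hq := norm_driftCoeff_le hν c h hk
  have hq0 : 0 ≤ ‖driftCoeff ν c h k‖ := norm_nonneg _
  set N := ‖mFourierCoeff (fun x => (h x : ℂ)) k‖ with hN
  have hN0 : 0 ≤ N := norm_nonneg _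
  have hden : 0 < 4 * Real.pi ^ 2 * ν * freqNormSq k := by positivity
  calc freqNormSq k * ‖driftCoeff ν c h k‖ ^ 2 ≤ freqNormSq k * (N / (4 * Real.pi ^ 2 * ν * freqNormSq k)) ^ 2 := by
        gcongr
    _ = N ^ 2 / ((4 * Real.pi ^ 2 * ν) ^ 2 * freqNormSq k) := by field_simp
    _ ≤ N ^ 2 / ((4 * Real.pi ^ 2 * ν) ^ 2 * 1) := by
        apply div_le_div_of_nonneg_left (by positivity) (by positivity)
        gcongr
    _ = ((4 * Real.pi ^ 2 * ν) ^ 2)⁻¹ * N ^ 2 := by ring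

end DriftLimsup


end Summit.AnomalousDissipation.AnomalousDissipation.Theorems.ScalarAnomalySteadySourceFormal.Negative
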